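import Literature.MathematicalPhysics.QuantumFieldTheory.Balaban1983to89.B9WalkLettersOpsO
import Summits.QuantumFields.YangMills.Theorems.BalabanUVNodesN06WalkLettersAtRecordR

/-!
# BalabanUVNodes ∕ N06 ([B9], `Dag.B9_main`) — THE rows-18 WALK LETTERS WITH A GENERIC CUBE LETTER `O` AT THE CERTIFICATE'S FIBRE: `Identities₂` FROM THE TWO (3.88)
# LOCAL-INVERSE LAWS OF `O`, `hloc` FROM THE LOCALITY OF `O`, AND THE LAWS DISCHARGED AT TODAY'S LETTER `O □ := GsqY … (cubeDomY x □)` (inputs of the road-(A) edition)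

Track A of `YM-PLAN.md` (cell `pub-ymgap`, HUMAN RULING D-0062), node **N06** = [Balaban1985BackgroundPropagators] Thms 3.1–3.15; seat `pub-ymgap-dag-n06-d` (gen 23), the
knit at the ₁₁ record.  WHY.  The W-a FILE C-3 `Literature/…/B9WalkLettersOpsO` (✓p769851) makes the certificate's cube-letter slot GENERIC (`opsWalkYO x b B cfg parS bI O`,
`rdWalkYO … near`) and states its laws with the letter's two (3.88) local-inverse laws (`hloc ∕ hlocT`) and its locality (`hO`) as HYPOTHESES.  This file is the
certificate-side twin of `…N06WalkLettersAtRecordR` for the generic record, at the certificate's fibre `M_N(ℂ)`, `G = SU(N)`, transporter `parSymY`, basis `trBasis N`: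
* §1 ★ `localityDir_opsWalkYO_of_agree` — any displayed reading `rd` with `rd.Agree = agreeWalkYO … near` inherits `localityDir_opsWalkYO` (given `nearDomY ⊆ near`, `hO`);
* §2 ★★ `identities₂_opsWalkYO_SU` ∕ ★★ `identities₂_opsWalkYO_of_reg335R` — `Identities₂` at `(opsWalkYO, dirOpsWalkYO, dirLettersWalkYO)` for every `SU(N)`-valued
  configuration ∕ every member of the certificate's (3.35) class, from the two laws of `O` AT THAT CONFIGURATION (contraction of bond variables ∕ transporters, `Δ′_a(U)`'s unit
  and `c_R > 0` discharged as in the `R` file);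
* §3 TODAY'S LETTER: ★ `hloc_GsqY_SU` ∕ ★ `hlocT_GsqY_SU` (node00-def-Y's `cutMulY_deltaPrimeAY_GsqY_cutMulY` ∕ `cutMulY_GsqY_deltaPrimeAY_cutMulY` with the compressed unit
  from Thm 3.11's positivity `isUnit_padDeltaY_parSymY`, support `mem_cubeDomY_of_hTY_ne_zero`) and ★ `hO_GsqY` (def-Y's `GsqY_congr_of_agree` at `near := nearDomY`) — so the
  road-(A) edition can display `O ∕ near` with `hOloc hOlocT hOagr` and STILL be inhabited at the letter of record by these three theorems (no vacuity).
HONEST FRAMING.  Kernel bookkeeping over LANDED modules (W-a FILE C-3 + def-Y's local-inverse algebra); the laws of a general `O` stay hypotheses; COUNT-NEUTRAL; NOT a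
discharge of N06; K1⁹ NOT closed; one finite 𝕋⁴ programme at fixed `ε` — NOT continuum ∕ OS ∕ mass gap ∕ Clay. 0 `def`, 0 `sorry`.  Cell `pub-ymgap` (D-0062), node N06 [B9],
seat `pub-ymgap-dag-n06-d` (gen 23), 2026-08-30.
[cite: Balaban1985BackgroundPropagators, (3.87)–(3.90) pp.408–410, (3.27) p.395, Thm 3.11 p.416; Balaban1984PropagatorsII, (2.36)–(2.44) pp.229–230]
-/

noncomputable section

namespace Summit.QuantumFields.YangMills.BalabanUVNodes.N06WalkLettersAtRecordRO

open Literature.MathematicalPhysics.QuantumFieldTheory.Balaban1983to89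
open Literature.MathematicalPhysics.QuantumFieldTheory.Balaban1983to89.Node00
open Literature.MathematicalPhysics.QuantumFieldTheory.Balaban1983to89.B6KLevelCensusIndexV1 (KIdx)
open Literature.MathematicalPhysics.QuantumFieldTheory.Balaban1983to89.B6Ineq2142KLevelV1 (β lvl)
open Literature.MathematicalPhysics.QuantumFieldTheory.Balaban1983to89.B6Cover236MultiLevelBlocks (cubes)
open Literature.MathematicalPhysics.QuantumFieldTheory.Balaban1983to89.B9PinMembersKLevelV1 (MemberY geo9Y)
open Literature.MathematicalPhysics.QuantumFieldTheory.Balaban1983to89.B7Prop2SpecialUnitary (specialUnitaryUnits specialUnitaryUnits_le_unitaryUnits)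
open Literature.MathematicalPhysics.QuantumFieldTheory.Balaban1983to89.B9Thm37Whole (Ops)
open Literature.MathematicalPhysics.QuantumFieldTheory.Balaban1983to89.B9RWSums346SecondDiffGp (DirOps37)
open Literature.MathematicalPhysics.QuantumFieldTheory.Balaban1983to89.B9Thm37WholeDir (DirLetters37 Identities₂)
open Literature.MathematicalPhysics.QuantumFieldTheory.Balaban1983to89.B9Cor38Whole (WalkReading)
open Literature.MathematicalPhysics.QuantumFieldTheory.Balaban1983to89.B9Cor38WholeDir (LocalityDir)
open Literature.MathematicalPhysics.QuantumFieldTheory.Balaban1983to89.B9Thm37CubeCoverCommutators (cutMulY hTY)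
open Literature.MathematicalPhysics.QuantumFieldTheory.Balaban1983to89.B9CoReadingCoordsTranspose (TrIdx trBasis)
open Literature.MathematicalPhysics.QuantumFieldTheory.Balaban1983to89.B9BackgroundsKLevelV1R (RegFamY MemOfFam bg9YR mem_of_reg335R)
open Literature.MathematicalPhysics.QuantumFieldTheory.Balaban1983to89.B9Thm311DeltaPrimePos (isUnit_deltaPrimeAY_parSymY)
open Literature.MathematicalPhysics.QuantumFieldTheory.Balaban1983to89.B9Thm311LocalInversePosY (isUnit_padDeltaY_parSymY)
open Literature.MathematicalPhysics.QuantumFieldTheory.Balaban1983to89.Node00.OpsYSectDCoords (cR39_trBasis_pos)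
open Literature.MathematicalPhysics.QuantumFieldTheory.Balaban1983to89.Node00.OpsYLocalInverse (GsqY cutMulY_deltaPrimeAY_GsqY_cutMulY)
open Literature.MathematicalPhysics.QuantumFieldTheory.Balaban1983to89.Node00.OpsYLeibnizLetters (cutMulY_GsqY_deltaPrimeAY_cutMulY)
open Literature.MathematicalPhysics.QuantumFieldTheory.Balaban1983to89.B9WalkLettersCoordsS (cubeDomY mem_cubeDomY_of_hTY_ne_zero)
open Literature.MathematicalPhysics.QuantumFieldTheory.Balaban1983to89.B9WalkLettersOps (nearDomY agreeWalkY rdWalkY)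
open Literature.MathematicalPhysics.QuantumFieldTheory.Balaban1983to89.B9WalkLettersOpsO (opsWalkYO dirOpsWalkYO dirLettersWalkYO agreeWalkYO rdWalkYO identities₂_opsWalkYO localityDir_opsWalkYO)
open N06WalkLettersAtRecordR (localityDir_of_agree_eq)

/-! ## §1 `LocalityDir` at the generic record for a displayed reading whose `Agree` is pinned -/

section Record

variable {d ℓ : ℕ} {hd : 1 ≤ d + 1} {hL : Odd (ℓ + 1) ∧ 1 < ℓ + 1} {b₀ b₁ : ℝ} {Mstar : ℕ}
variable {𝔸 : Type} [NormedRing 𝔸] [NormedAlgebra ℂ 𝔸] [CompleteSpace 𝔸] [FiniteDimensional ℝ 𝔸] {κ : Type} [Fintype κ] [DecidableEq κ]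
variable (x : MemberY d ℓ hd hL b₀ b₁ Mstar) (b : Module.Basis κ ℝ 𝔸) (B : B9.Backgrounds) (cfg : B.Cfg → CfgY 𝔸 x.toKIdx) (parS : SiteParY 𝔸 x.toKIdx)
variable (bI : FBondY x.toKIdx → IBondY x.toKIdx) (O : ↥(cubes x.toKIdx.D.toDomains) → SiteOpY 𝔸 x.toKIdx)

/-- ★ **`hloc` AT THE GENERIC RECORD FOR A DISPLAYED READING WHOSE `Agree` IS PINNED** to `agreeWalkYO … near`: from `localityDir_opsWalkYO` (locality of `O` on `near`,
`□̃ + 1 ⊆ near`). [cite: Balaban1985BackgroundPropagators, Cor. 3.8 p.410 L14–15 («G′_□ depends on U restricted to Ω₀(□) ⊂ □̃⁵, and the operator K(h) is semi-local»)] -/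
theorem localityDir_opsWalkYO_of_agree (near : ↥(cubes x.toKIdx.D.toDomains) → Finset (SiteY x.toKIdx)) (hnear : ∀ c, nearDomY x c ⊆ near c)
    (hO : ∀ (c : ↥(cubes x.toKIdx.D.toDomains)) (U U' : B.Cfg), agreeWalkYO x B cfg parS near c U U' → O c (cfg U) = O c (cfg U'))
    (rd : WalkReading (geo9Y x) B (B9CoReadingCoordsS.XSK κ x.toKIdx) ↥(cubes x.toKIdx.D.toDomains)) (h : rd.Agree = agreeWalkYO x B cfg parS near) :
    LocalityDir (opsWalkYO x b B cfg parS bI O) (dirOpsWalkYO x b B cfg parS bI O) (dirLettersWalkYO x b B cfg parS bI O) rd :=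
  localityDir_of_agree_eq (rd' := rdWalkYO x B cfg parS near) h (localityDir_opsWalkYO x b B cfg parS bI O near hnear hO)

omit [Fintype κ] [DecidableEq κ] [FiniteDimensional ℝ 𝔸] in
/-- ★ **TODAY'S LETTER IS LOCAL ON TODAY'S DOMAIN**: `O □ := GsqY … (cubeDomY x □)` satisfies `hO` at `near := nearDomY x` (node00-def-Y's `GsqY_congr_of_agree`).
[cite: Balaban1985BackgroundPropagators, p.410 L14–15, (3.87) p.409, bookkeeping] -/
theorem hO_GsqY (c : ↥(cubes x.toKIdx.D.toDomains)) (U U' : B.Cfg) (hA : agreeWalkYO x B cfg parS (nearDomY x) c U U') :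
    GsqY x.toKIdx parS (cubeDomY x c) (cfg U) = GsqY x.toKIdx parS (cubeDomY x c) (cfg U') :=
  B9WalkLettersOpsLocality.GsqY_congr_of_agreeWalkY x B cfg parS c hA

end Record

/-! ## §2 `Identities₂` at the generic record for `SU(N)`-valued configurations; §3 the laws at today's letter -/

section SU

open scoped Matrix.Norms.L2Operator

variable {d ℓ : ℕ} {hd : 1 ≤ d + 1} {hL : Odd (ℓ + 1) ∧ 1 < ℓ + 1} {b₀ b₁ : ℝ} {Mstar : ℕ} {N : ℕ} [NeZero N]
variable (x : MemberY d ℓ hd hL b₀ b₁ Mstar) (B : B9.Backgrounds) (cfg : B.Cfg → CfgY (Matrix (Fin N) (Fin N) ℂ) x.toKIdx)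
variable (bI : FBondY x.toKIdx → IBondY x.toKIdx) [Fintype (geo9Y x).Site] (O : ↥(cubes x.toKIdx.D.toDomains) → SiteOpY (Matrix (Fin N) (Fin N) ℂ) x.toKIdx)

/-- ★★ **`Identities₂` AT THE GENERIC RECORD FOR EVERY `SU(N)`-VALUED CONFIGURATION, FROM THE TWO (3.88) LAWS OF `O` AT THAT CONFIGURATION** (contraction of the bond
variables ∕ averaging transporters, the unit `Δ′_a(U)` (Thm 3.11) and `c_R > 0` discharged at the fibre `M_N(ℂ)`, basis `trBasis N`, transporter `parSymY`).
[cite: Balaban1985BackgroundPropagators, (3.87)–(3.88) pp.408–409, (3.100) p.413, (3.25)–(3.27) p.395, Thm 3.11 p.416; Balaban1984PropagatorsII, (2.39)–(2.40) pp.229–230] -/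
theorem identities₂_opsWalkYO_SU (R : ℝ) (H : Prop)
    (hβ1 : ∀ f : FBondY x.toKIdx, (B6Geom246MultiLevelTorus.geomT x.D).dist (β x.hN x.D x.hk (bI f)) (B6GlobalChartV1.blkV1 x.hN x.D f) ≤ 1)
    (hlev : ∀ f : FBondY x.toKIdx, lvl x.hN x.D x.hk (bI f) = (B6GlobalChartV1.blkV1 x.hN x.D f).1.1)
    (U : B.Cfg) (hU : ∀ μ y, cfg U μ y ∈ specialUnitaryUnits (Fin N))
    (hloc : ∀ c : ↥(cubes x.toKIdx.D.toDomains),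
      cutMulY (hTY x.toKIdx c) * deltaPrimeAY x.toKIdx (parSymY x.toKIdx) (cfg U) * O c (cfg U) * cutMulY (hTY x.toKIdx c) = cutMulY (hTY x.toKIdx c) * cutMulY (hTY x.toKIdx c))
    (hlocT : ∀ c : ↥(cubes x.toKIdx.D.toDomains),
      cutMulY (hTY x.toKIdx c) * O c (cfg U) * deltaPrimeAY x.toKIdx (parSymY x.toKIdx) (cfg U) * cutMulY (hTY x.toKIdx c) = cutMulY (hTY x.toKIdx c) * cutMulY (hTY x.toKIdx c)) :
    Identities₂ (opsWalkYO x (trBasis N) B cfg (parSymY x.toKIdx) bI O) (dirOpsWalkYO x (trBasis N) B cfg (parSymY x.toKIdx) bI O)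
      (dirLettersWalkYO x (trBasis N) B cfg (parSymY x.toKIdx) bI O) R H U := by
  have h1 := fun (g : (Matrix (Fin N) (Fin N) ℂ)ˣ) (hg : g ∈ specialUnitaryUnits (Fin N)) => norm_coe_le_one_specialUnitaryUnits g hg
  have hbox : ∀ (μ : Fin (d + 1)) (w : SiteY x.toKIdx), UboxY x.toKIdx (cfg U) μ w ∈ specialUnitaryUnits (Fin N) := fun μ w => hU μ _
  have havg : ∀ z w : SiteY x.toKIdx, avgTrY x.toKIdx (parSymY x.toKIdx) (cfg U) z w ∈ specialUnitaryUnits (Fin N) := fun z w =>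
    Subgroup.mul_mem _ (parSymY_mem x.toKIdx hU _ _) (parSymY_mem x.toKIdx hU _ _)
  exact identities₂_opsWalkYO x (trBasis N) B cfg (parSymY x.toKIdx) bI O R H hβ1 hlev (cR39_trBasis_pos (NeZero.pos N)).ne' U
    (fun μ w => ⟨h1 _ (hbox μ w), h1 _ (Subgroup.inv_mem _ (hbox μ w))⟩)
    (fun z w => ⟨h1 _ (havg z w), h1 _ (Subgroup.inv_mem _ (havg z w))⟩)
    (isUnit_deltaPrimeAY_parSymY x.toKIdx specialUnitaryUnits_le_unitaryUnits hU) hloc hlocT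

/-- ★★ **… READ FROM A (3.35)-MEMBERSHIP OF A `SU(N)`-VALUED REGULARITY FAMILY** (the certificate's carrier `bg9YR M_N(ℂ) SU(N) R₁ R₂`, `cfg := id`): the shape of the premises
of the certificate's rows-18 letters, with the two laws of `O` at `U`. [cite: Balaban1985BackgroundPropagators, (3.35) p.396 («U with values in G»), (3.87)–(3.88) pp.408–409] -/
theorem identities₂_opsWalkYO_of_reg335R {R₁ R₂ : RegFamY d ℓ hd hL b₀ b₁ Mstar (Matrix (Fin N) (Fin N) ℂ)} (hGR : MemOfFam (specialUnitaryUnits (Fin N)) R₁)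
    (O : ↥(cubes x.toKIdx.D.toDomains) → SiteOpY (Matrix (Fin N) (Fin N) ℂ) x.toKIdx) (R : ℝ) (H : Prop)
    (hβ1 : ∀ f : FBondY x.toKIdx, (B6Geom246MultiLevelTorus.geomT x.D).dist (β x.hN x.D x.hk (bI f)) (B6GlobalChartV1.blkV1 x.hN x.D f) ≤ 1)
    (hlev : ∀ f : FBondY x.toKIdx, lvl x.hN x.D x.hk (bI f) = (B6GlobalChartV1.blkV1 x.hN x.D f).1.1)
    {c α₀ : ℝ} {U : (bg9YR (Matrix (Fin N) (Fin N) ℂ) (specialUnitaryUnits (Fin N)) R₁ R₂ x).Cfg}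
    (hU : (bg9YR (Matrix (Fin N) (Fin N) ℂ) (specialUnitaryUnits (Fin N)) R₁ R₂ x).Reg335 c α₀ U)
    (hloc : ∀ c : ↥(cubes x.toKIdx.D.toDomains),
      cutMulY (hTY x.toKIdx c) * deltaPrimeAY x.toKIdx (parSymY x.toKIdx) U * O c U * cutMulY (hTY x.toKIdx c) = cutMulY (hTY x.toKIdx c) * cutMulY (hTY x.toKIdx c))
    (hlocT : ∀ c : ↥(cubes x.toKIdx.D.toDomains),
      cutMulY (hTY x.toKIdx c) * O c U * deltaPrimeAY x.toKIdx (parSymY x.toKIdx) U * cutMulY (hTY x.toKIdx c) = cutMulY (hTY x.toKIdx c) * cutMulY (hTY x.toKIdx c)) :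
    Identities₂ (opsWalkYO x (trBasis N) (bg9YR (Matrix (Fin N) (Fin N) ℂ) (specialUnitaryUnits (Fin N)) R₁ R₂ x) (fun U => U) (parSymY x.toKIdx) bI O)
      (dirOpsWalkYO x (trBasis N) (bg9YR (Matrix (Fin N) (Fin N) ℂ) (specialUnitaryUnits (Fin N)) R₁ R₂ x) (fun U => U) (parSymY x.toKIdx) bI O)
      (dirLettersWalkYO x (trBasis N) (bg9YR (Matrix (Fin N) (Fin N) ℂ) (specialUnitaryUnits (Fin N)) R₁ R₂ x) (fun U => U) (parSymY x.toKIdx) bI O) R H U :=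
  identities₂_opsWalkYO_SU x (bg9YR (Matrix (Fin N) (Fin N) ℂ) (specialUnitaryUnits (Fin N)) R₁ R₂ x) (fun U => U) bI O R H hβ1 hlev U (mem_of_reg335R hGR x hU)
    hloc hlocT

omit [NeZero N] [Fintype (geo9Y x).Site] in
/-- ★ **TODAY'S LETTER SATISFIES THE ROW LAW AT EVERY `SU(N)`-VALUED CONFIGURATION**: `h_□·Δ′_a(U)·GsqY … (cubeDomY x □) U·h_□ = h_□²` (node00-def-Y's
`cutMulY_deltaPrimeAY_GsqY_cutMulY`; the compressed unit from Thm 3.11's positivity; `supp h_□ ⊂ □̃`). [cite: Balaban1985BackgroundPropagators, (3.87)–(3.88) p.409, (3.27) p.395, Thm 3.11 p.416] -/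
theorem hloc_GsqY_SU (U : B.Cfg) (hU : ∀ μ y, cfg U μ y ∈ specialUnitaryUnits (Fin N)) (c : ↥(cubes x.toKIdx.D.toDomains)) :
    cutMulY (hTY x.toKIdx c) * deltaPrimeAY x.toKIdx (parSymY x.toKIdx) (cfg U) * GsqY x.toKIdx (parSymY x.toKIdx) (cubeDomY x c) (cfg U) * cutMulY (hTY x.toKIdx c)
      = cutMulY (hTY x.toKIdx c) * cutMulY (hTY x.toKIdx c) :=
  cutMulY_deltaPrimeAY_GsqY_cutMulY x.toKIdx (parSymY x.toKIdx) (isUnit_padDeltaY_parSymY x.toKIdx specialUnitaryUnits_le_unitaryUnits hU (cubeDomY x c))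
    (hTY x.toKIdx c) (fun _ hz => mem_cubeDomY_of_hTY_ne_zero x c hz)

omit [NeZero N] [Fintype (geo9Y x).Site] in
/-- ★ **… AND THE COLUMN LAW**: `h_□·GsqY … (cubeDomY x □) U·Δ′_a(U)·h_□ = h_□²` (node00-def-Y's `cutMulY_GsqY_deltaPrimeAY_cutMulY`).
[cite: Balaban1985BackgroundPropagators, (3.87)–(3.88) p.409, (3.27) p.395, Thm 3.11 p.416] -/
theorem hlocT_GsqY_SU (U : B.Cfg) (hU : ∀ μ y, cfg U μ y ∈ specialUnitaryUnits (Fin N)) (c : ↥(cubes x.toKIdx.D.toDomains)) :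
    cutMulY (hTY x.toKIdx c) * GsqY x.toKIdx (parSymY x.toKIdx) (cubeDomY x c) (cfg U) * deltaPrimeAY x.toKIdx (parSymY x.toKIdx) (cfg U) * cutMulY (hTY x.toKIdx c)
      = cutMulY (hTY x.toKIdx c) * cutMulY (hTY x.toKIdx c) :=
  cutMulY_GsqY_deltaPrimeAY_cutMulY x.toKIdx (parSymY x.toKIdx) (isUnit_padDeltaY_parSymY x.toKIdx specialUnitaryUnits_le_unitaryUnits hU (cubeDomY x c))
    (hTY x.toKIdx c) (fun _ hz => mem_cubeDomY_of_hTY_ne_zero x c hz)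

end SU

end Summit.QuantumFields.YangMills.BalabanUVNodes.N06WalkLettersAtRecordRO

end
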